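import Summits.ResolutionOfSingularities.ResolutionOfSingularities.Theses.SectionAscent
import Literature.AlgebraicGeometry.Resolution.AffineBlowupUniversal
import Literature.AlgebraicGeometry.Resolution.BlowupChartMembership
import Literature.AlgebraicGeometry.Resolution.FieldsJ2

/-!
# `FibrewiseClosedPoints` — negative lemmas: the hypothesis `Almost` is decoration

Support (negative) lemmas for crux `stmt-ResolutionOfSingularities-15960`
(`Summit.ResolutionOfSingularities.ResolutionOfSingularities.Theses.SectionAscent.FibrewiseClosedPoints`,
route SectionAscent: `∀ p prime, ∀ d, OneShot p d → Almost p (d+1) → OneShot p (d+1)`), filed by the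
refuter's crux attack (2026-08-17). This file declares NO definition; every variant statement is
written out inline, and NO declaration concludes a route decl positively.

The intermediate predicate `Almost p d` of the route ("one NORMAL blowing up `Bl_I`, `I ≠ 0`,
`V(I) ⊇ Sing`, regular at every point NOT CLOSED IN ITS FIBRE") does not pin the blowing up down:
it only asks `V(I) ⊇ Sing(Spec A)` (`¬ I ≤ 𝔭 → A_𝔭 regular`), so it is satisfied by JUNK WITNESSES
that carry no information about the singularities:

* `isIso_affineBlowup_π_span_singleton` — the ideal sheaf of a principal ideal `(f)`, `f` a
  nonzerodivisor, is already effective Cartier (tree: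
  `affineBlowup.isEffectiveCartier_idealSheaf_span_singleton`), so by the universal property
  (`IsBlowup.isIso`) **`Bl_(f)(Spec A) → Spec A` is an isomorphism**.
* `almostBody_span_singleton` — hence for a NORMAL domain `A` and any `f ≠ 0` with
  `D(f) ⊆ Reg(Spec A)` the ideal `I = (f)` satisfies the body of `Almost`: `I ≠ 0`; `A_𝔭` regular
  off `V(f)`; every stalk of `Bl_I ≅ Spec A` is integrally closed; and the fibrewise clause is
  VACUOUS because `π` is injective (no point has a proper specialisation inside its fibre).
* `almostBody_of_isIntegrallyClosed` — such an `f` always exists (fields are J-2 and the generic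
  point is regular: `exists_ne_zero_forall_isRegularLocalRing_of_finiteType_field`), so **the body of
  `Almost p d` holds for every field `K`, every `p`, every `d` and every NORMAL affine domain of
  finite type over `K`, of any dimension, with no resolution content whatsoever.** (For a
  non-normal `A` the same junk works with `I = f · sÃ`, `0 ≠ s` in the conductor: `Bl_{sÃ}(Spec A)`
  is the finite normalisation `Spec Ã`, all of whose points are closed in their fibres — on paper.)
* `oneShotBody_one` — NON-VACUITY: the body of `OneShot p 1` holds (dimension-`0` domains are fields,
  `Bl_⊤ ≅ Spec L`), so the crux's implication chain starts from satisfiable hypotheses.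
* `not_fibrewiseClosedPoints_of_not_oneShotAffine` — consequently, granted the body of `Almost`
  for all affine domains (previous item), the crux is REFUTED BY ANY FAILURE OF THE ROUTE TARGET
  `OneShotAffine`: by the route's own induction (`OneShot p 0` is vacuous) the crux then implies the
  target, i.e. `FibrewiseClosedPoints` RESTATES `OneShotAffine` (strong one-shot resolution of affine
  varieties in every dimension, open from dimension 4) instead of isolating "closed points of fibres".

Repair for the planner (not filed here): in `Almost` require the centre to be EXACTLY the singular
locus (`I ≤ 𝔭.asIdeal ↔ ¬ IsRegularLocalRing A_𝔭`, as in `OneShot`) — at a normal singular point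
`w` the singular locus has codimension `≥ 2`, so by Krull's Hauptidealsatz no such `I` is invertible
at `w` and the finite/isomorphic junk above is excluded.

## Sources
* U. Görtz, T. Wedhorn, *Algebraic Geometry I* (2nd ed. 2020), Def. 13.90 and the remark following
  it (blowing up an effective Cartier divisor is an isomorphism); The Stacks Project, Tag 0804.
* H. Matsumura, *Commutative Ring Theory* (1986), §30–32 (J-2, generic regularity over a field).
-/

noncomputable section

set_option linter.dupNamespace false -- mandated namespace of this single-conjunct summit

open CategoryTheory AlgebraicGeometry TopologicalSpace
open Literature.AlgebraicGeometry.Resolution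
open Summit.ResolutionOfSingularities.ResolutionOfSingularities.Theses.SectionAscent

namespace Summit.ResolutionOfSingularities.ResolutionOfSingularities.Theorems.FibrewiseClosedPoints.Negative

universe u

/-- **Blowing up a principal ideal generated by a nonzerodivisor is an isomorphism**
(`IsBlowup.isIso` for the constructed `Bl_(f)(Spec A) = Proj A[(f)t] → Spec A`).
[cite: GortzWedhorn2020, (13.19) p. 413] -/
theorem isIso_affineBlowup_π_span_singleton {A : Type u} [CommRing A] {f : A}
    (hf : f ∈ nonZeroDivisors A) : IsIso (affineBlowup.π (Ideal.span {f})) :=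
  (affineBlowup.isBlowup _).isIso (affineBlowup.isEffectiveCartier_idealSheaf_span_singleton hf)

/-- The local rings of `Spec A`, `A` an integrally closed domain, are integrally closed (they are
the localisations `A_𝔭`). [folklore] -/
theorem isIntegrallyClosed_stalk_Spec_of_isIntegrallyClosed (A : Type u) [CommRing A] [IsDomain A]
    [IsIntegrallyClosed A] (x : Spec (.of A)) :
    IsIntegrallyClosed ((Spec (.of A)).presheaf.stalk x) := by
  letI : Algebra A ((Spec (.of A)).presheaf.stalk x) :=
    inferInstanceAs (Algebra A ((Spec.structureSheaf A).presheaf.stalk x))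
  haveI : IsLocalization.AtPrime ((Spec (.of A)).presheaf.stalk x) x.asIdeal :=
    StructureSheaf.IsLocalization.to_stalk A x
  exact isIntegrallyClosed_of_isLocalization _ x.asIdeal.primeCompl
    (Ideal.primeCompl_le_nonZeroDivisors _)

/-- **The junk witness.** For a normal domain `A` and `f ≠ 0` with `D(f) ⊆ Reg(Spec A)`, the
principal ideal `I = (f)` satisfies the body of the route's predicate `Almost`: `I ≠ 0`, `A_𝔭` is
regular off `V(I)`, every local ring of `Bl_I(Spec A)` is integrally closed, and `Bl_I` is regular
at every point not closed in its fibre — the last clause VACUOUSLY, `Bl_I → Spec A` being an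
isomorphism (no two distinct points share a fibre). [folklore] -/
theorem almostBody_span_singleton {A : Type u} [CommRing A] [IsDomain A] [IsIntegrallyClosed A]
    {f : A} (hf : f ≠ 0)
    (hreg : ∀ 𝔭 : PrimeSpectrum A, f ∉ 𝔭.asIdeal →
      IsRegularLocalRing (Localization.AtPrime 𝔭.asIdeal)) :
    Ideal.span {f} ≠ ⊥ ∧
      (∀ 𝔭 : PrimeSpectrum A, ¬ Ideal.span {f} ≤ 𝔭.asIdeal →
        IsRegularLocalRing (Localization.AtPrime 𝔭.asIdeal)) ∧
      (∀ y : affineBlowup (Ideal.span {f}),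
        IsIntegrallyClosed ((affineBlowup (Ideal.span {f})).presheaf.stalk y)) ∧
      ∀ y : affineBlowup (Ideal.span {f}),
        (∃ z : affineBlowup (Ideal.span {f}), z ≠ y ∧ y ⤳ z ∧
          (affineBlowup.π (Ideal.span {f})).base z = (affineBlowup.π (Ideal.span {f})).base y) →
        IsRegularLocalRing ((affineBlowup (Ideal.span {f})).presheaf.stalk y) := by
  haveI hiso : IsIso (affineBlowup.π (Ideal.span {f})) :=
    isIso_affineBlowup_π_span_singleton (mem_nonZeroDivisors_of_ne_zero hf)
  refine ⟨?_, ?_, ?_, ?_⟩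
  · simpa [Ideal.span_singleton_eq_bot] using hf
  · intro 𝔭 h𝔭
    apply hreg
    rwa [Ideal.span_singleton_le_iff_mem] at h𝔭
  · intro y
    haveI := isIntegrallyClosed_stalk_Spec_of_isIntegrallyClosed A
      ((affineBlowup.π (Ideal.span {f})).base y)
    exact IsIntegrallyClosed.of_equiv
      (asIso ((affineBlowup.π (Ideal.span {f})).stalkMap y)).commRingCatIsoToRingEquiv
  · rintro y ⟨z, hzy, -, hπ⟩
    exact absurd ((affineBlowup.π (Ideal.span {f})).isOpenEmbedding.injective hπ) hzy

/-- **`Almost` is decoration on normal varieties.** For every field `K`, every normal affine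
domain `A` of finite type over `K` — of ANY dimension, in ANY characteristic — the body of the
route's `Almost p d` holds, witnessed by a principal ideal `(f)` with `D(f) ⊆ Reg(Spec A)` (such an
`f ≠ 0` exists: fields are J-2 and the generic point is regular). No resolution content is used.
[folklore] -/
theorem almostBody_of_isIntegrallyClosed (K : Type u) [Field K] (A : Type u) [CommRing A]
    [IsDomain A] [Algebra K A] [Algebra.FiniteType K A] [IsIntegrallyClosed A] :
    ∃ I : Ideal A, I ≠ ⊥ ∧
      (∀ 𝔭 : PrimeSpectrum A, ¬ I ≤ 𝔭.asIdeal →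
        IsRegularLocalRing (Localization.AtPrime 𝔭.asIdeal)) ∧
      (∀ y : affineBlowup I, IsIntegrallyClosed ((affineBlowup I).presheaf.stalk y)) ∧
      ∀ y : affineBlowup I, (∃ z : affineBlowup I, z ≠ y ∧ y ⤳ z ∧
        (affineBlowup.π I).base z = (affineBlowup.π I).base y) →
          IsRegularLocalRing ((affineBlowup I).presheaf.stalk y) := by
  obtain ⟨f, hf, hreg⟩ := exists_ne_zero_forall_isRegularLocalRing_of_finiteType_field K A
  exact ⟨Ideal.span {f}, almostBody_span_singleton hf fun 𝔭 h => hreg 𝔭.asIdeal h⟩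

/-- **Non-vacuity of the first level (`OneShot p 1` holds).** The body of the route's `OneShot p d`
at `d = 0 + 1` — the conclusion of the crux instance `d = 0` and the hypothesis of the instance
`d = 1` — is TRUE: a domain of Krull dimension `< 1` is a field `L` (Mathlib
`Ring.KrullDimLE.isField_of_isDomain`), the unit ideal `⊤ = (1)` is nonzero, its blowing up
`Bl_(1)(Spec L) ≅ Spec L` has fields as stalks (regular), and `V(⊤) = ∅ = Sing(Spec L)`. So the
implication chain of the crux starts from satisfiable hypotheses (in print it is true up to
`d + 1 = 4`, CossartPiltant2019). [folklore] -/
theorem oneShotBody_one (A : Type) [CommRing A] [IsDomain A]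
    (hdim : ringKrullDim A < ((0 + 1 : ℕ) : WithBot ℕ∞)) :
    ∃ I : Ideal A, I ≠ ⊥ ∧ Scheme.IsRegular (affineBlowup I) ∧
      ∀ 𝔭 : PrimeSpectrum A, I ≤ 𝔭.asIdeal ↔ ¬ IsRegularLocalRing (Localization.AtPrime 𝔭.asIdeal) := by
  -- `A` is a field
  have hle : ringKrullDim A ≤ (0 : ℕ) := by
    have : ringKrullDim A < ((0 : ℕ) : WithBot ℕ∞) + 1 := by simpa using hdim
    exact ENat.WithBot.lt_add_one_iff.mp this
  haveI : Ring.KrullDimLE 0 A := Ring.krullDimLE_iff.mpr hle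
  have hA : IsField A := Ring.KrullDimLE.isField_of_isDomain
  -- every localization of the field `A` at a submonoid missing `0` is a field
  have key : ∀ (M : Submonoid A), (0 : A) ∉ M → ∀ (B : Type) [CommRing B] [Algebra A B]
      [IsLocalization M B], IsField B := by
    intro M hM B _ _ _
    have hunits : M ≤ IsUnit.submonoid A := by
      intro m hm
      letI := hA.toField
      exact isUnit_iff_ne_zero.mpr (fun h => hM (h ▸ hm))
    exact MulEquiv.isField hA (IsLocalization.atUnits A M (S := B) hunits).symm.toMulEquiv
  have hlocreg : ∀ 𝔭 : PrimeSpectrum A, IsRegularLocalRing (Localization.AtPrime 𝔭.asIdeal) := by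
    intro 𝔭
    have hF : IsField (Localization.AtPrime 𝔭.asIdeal) :=
      key 𝔭.asIdeal.primeCompl (fun h => h (Ideal.zero_mem _)) _
    letI := hF.toField
    infer_instance
  refine ⟨⊤, top_ne_bot, ?_, ?_⟩
  · -- `Bl_⊤ = Bl_(1) ≅ Spec A`, whose stalks are fields
    haveI hiso : IsIso (affineBlowup.π (⊤ : Ideal A)) := by
      have h := isIso_affineBlowup_π_span_singleton (A := A) (f := 1) (Submonoid.one_mem _)
      rwa [Ideal.span_singleton_one] at h
    intro y
    letI : Algebra A ((Spec (.of A)).presheaf.stalk ((affineBlowup.π (⊤ : Ideal A)).base y)) :=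
      inferInstanceAs (Algebra A ((Spec.structureSheaf A).presheaf.stalk _))
    haveI : IsLocalization.AtPrime ((Spec (.of A)).presheaf.stalk
        ((affineBlowup.π (⊤ : Ideal A)).base y)) ((affineBlowup.π (⊤ : Ideal A)).base y).asIdeal :=
      StructureSheaf.IsLocalization.to_stalk A _
    have hF : IsField ((Spec (.of A)).presheaf.stalk ((affineBlowup.π (⊤ : Ideal A)).base y)) :=
      key ((affineBlowup.π (⊤ : Ideal A)).base y).asIdeal.primeCompl
        (fun h => h (Ideal.zero_mem _)) _
    haveI : IsRegularLocalRing ((Spec (.of A)).presheaf.stalk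
        ((affineBlowup.π (⊤ : Ideal A)).base y)) := by
      letI := hF.toField
      infer_instance
    exact IsRegularLocalRing.of_ringEquiv
      (asIso ((affineBlowup.π (⊤ : Ideal A)).stalkMap y)).commRingCatIsoToRingEquiv
  · intro 𝔭
    constructor
    · intro h
      exact absurd (top_le_iff.mp h) 𝔭.isPrime.ne_top
    · intro h
      exact absurd (hlocreg 𝔭) h

/-- **The crux restates the target.** Granted the body of `Almost` for all affine domains (it holds
by junk witnesses: `almostBody_of_isIntegrallyClosed` for normal `A`; `I = f · sÃ` with
`Bl = ` the finite normalisation in general), ANY failure of the route target `OneShotAffine`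
(one-shot strong resolution of affine varieties, open from dimension `4` in every characteristic
`p > 0`) refutes the crux `FibrewiseClosedPoints`: the route's own induction on `d` (base `d = 0`
vacuous, a domain having `ringKrullDim ≥ 0`) turns the crux plus `Almost` into the target. So the
hypothesis `Almost p (d+1)` hands the prover nothing and the crux is the whole inductive step
`OneShot p d → OneShot p (d+1)`. [folklore] -/
theorem not_fibrewiseClosedPoints_of_not_oneShotAffine
    (hAlmost : ∀ p : ℕ, p.Prime → ∀ d : ℕ, ∀ (K : Type) [Field K] [CharP K p] (A : Type) [CommRing A]
      [IsDomain A] [Algebra K A] [Algebra.FiniteType K A], ringKrullDim A < (d : WithBot ℕ∞) →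
      ∃ I : Ideal A, I ≠ ⊥ ∧
        (∀ 𝔭 : PrimeSpectrum A, ¬ I ≤ 𝔭.asIdeal →
          IsRegularLocalRing (Localization.AtPrime 𝔭.asIdeal)) ∧
        (∀ y : affineBlowup I, IsIntegrallyClosed ((affineBlowup I).presheaf.stalk y)) ∧
        ∀ y : affineBlowup I, (∃ z : affineBlowup I, z ≠ y ∧ y ⤳ z ∧
          (affineBlowup.π I).base z = (affineBlowup.π I).base y) →
            IsRegularLocalRing ((affineBlowup I).presheaf.stalk y))
    (hTarget : ¬ OneShotAffine) : ¬ FibrewiseClosedPoints := by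
  intro h
  apply hTarget
  intro p hp d
  induction d with
  | zero =>
      intro K _ _ A _ _ _ _ hdim
      exfalso
      have h0 : (0 : WithBot ℕ∞) ≤ ringKrullDim A := ringKrullDim_nonneg_of_nontrivial
      exact absurd hdim (not_lt.mpr (by simpa using h0))
  | succ d ih => exact h p hp d ih (hAlmost p hp (d + 1))

end Summit.ResolutionOfSingularities.ResolutionOfSingularities.Theorems.FibrewiseClosedPoints.Negative

end
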